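import Summits.AtomisticToContinuum.BoseEinsteinCondensation.Theorems.BECGroundStateSOSPeriodicIRBoundTwoSectorDefs
import Literature.MathematicalPhysics.QuantumManyBody.LatticePowerSums
import Mathlib.Analysis.SpecialFunctions.Pow.Real
import HarnessLib

/-!
# Line `insertion-mode-gaussian-domination`, stub S4 `stub_modeCount` — real and lattice arithmetic
# (crux `BECInsertionCorrector.CorrectorClosure`, item stmt-AtomisticToContinuum-12058; auxiliary file 1 of 3)

Supports (does not close) stmt-AtomisticToContinuum-12058. Pure real-number bookkeeping of the `d = 3` mode count
(Kennedy–Lieb–Shastry 1988, (5)–(9); Lieb–Seiringer–Solovej–Yngvason 2005, Thm 2.2) used by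
`BECInsertionCorrectorCorrectorClosureModeCount.lean`:

* `modeCount_perMode` — the per-mode step (with `TwoSectorGdTransfer.kls_quadratic`): the hole-channel KLS
  inequality `x² ≤ b (P + Λ + μ_N x − μ_{N+1}(x+1))` at the Gaussian-domination value `b = Bρ/P²`, together with
  monotonicity `E₀(N+1) ≤ E₀(N+2)` and near-convexity `2E₀(N+1) ≤ E₀(N+2) + E₀(N) + η`, gives
  `x ≤ Bρη/P² + √(Bρ/P) + √(BρΛ)/P`, and with `P ≥ c²σ²` (`c = 2π/L`, `σ = ‖k‖_∞ ≥ 1`) the profile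
  `A₄/σ⁴ + A₁/σ + A₂/σ²`;
* `modeCount_windowSum_le` — the `d = 3` lattice sums of that profile over a sup-norm shell `1 ≤ ‖k‖_∞ ≤ M`:
  `∑ ≤ 192 A₄ + 96 A₁ M² + 96 A₂ M` (`LatticePowerSums`: `∑‖k‖_∞⁻⁴ ≤ 192`, `∑‖k‖_∞⁻¹ ≤ 96M²`, `∑‖k‖_∞⁻² ≤ 96M`);
* `modeCount_window_small` — with `M ≤ M₀√ρ√a L/(2π)`, `ρL³ = N+1`, the three window terms are
  `(N+1)·√ρ·K(a, B, ‖v‖₁, M₀)`, hence `≤ (N+1)/8` once `√ρ (8K + 8) ≤ 1`;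
* `modeCount_window_total` — the three steps composed (the registered auxiliary stub): the infrared window of the
  mode count carries at most `(N+1)/8` particles.

No definitions; nothing here is specific to the Bose gas.
-/

noncomputable section

open scoped BigOperators

namespace Summit.AtomisticToContinuum.BoseEinsteinCondensation.Theorems.CorrectorClosure.InsertionModeGaussianDomination

open Literature.MathematicalPhysics.QuantumManyBody.BoseGas
open Summit.AtomisticToContinuum.BoseEinsteinCondensation.Cruxes.PeriodicIRBound.TwoSectorGdTransfer (kls_quadratic)

/-! ### The per-mode step -/

/-- **Per-mode bound (real form).** If `x ≥ 0` satisfies the hole-channel KLS inequality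
`x² ≤ (Bρ/P²)·(P + Λ + (e₁ − e₀) x − (e₂ − e₁)(x + 1))` with `e₁ ≤ e₂` (monotonicity of the energy in `N`)
and `2e₁ ≤ e₂ + e₀ + η` (near-convexity), then `x ≤ Bρη/P² + √(Bρ/P) + √(BρΛ)/P`; if moreover
`c²σ² ≤ P` with `c, σ > 0`, then `x ≤ (Bρη/c⁴)/σ⁴ + (√B√ρ/c)/σ + (√B√ρ√Λ/c²)/σ²`.
[cite: KLS1988PRL, (5)–(9)] -/
theorem modeCount_perMode {x P Λ e₀ e₁ e₂ η B ρ c σ : ℝ} (hx : 0 ≤ x) (hΛ : 0 ≤ Λ)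
    (hη : 0 ≤ η) (hB : 0 ≤ B) (hρ : 0 ≤ ρ) (h12 : e₁ ≤ e₂) (hconv : 2 * e₁ ≤ e₂ + e₀ + η)
    (hkls : x ^ 2 ≤ B * ρ / P ^ 2 * (P + Λ + (e₁ - e₀) * x - (e₂ - e₁) * (x + 1)))
    (hc : 0 < c) (hσ : 0 < σ) (hPσ : c ^ 2 * σ ^ 2 ≤ P) :
    x ≤ B * ρ * η / c ^ 4 / σ ^ 4 + Real.sqrt B * Real.sqrt ρ / c / σ +
      Real.sqrt B * Real.sqrt ρ * Real.sqrt Λ / c ^ 2 / σ ^ 2 := by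
  have hcσ : 0 < c * σ := mul_pos hc hσ
  have hcσ2 : 0 < c ^ 2 * σ ^ 2 := by positivity
  have hP : 0 < P := lt_of_lt_of_le hcσ2 hPσ
  set b : ℝ := B * ρ / P ^ 2 with hb_def
  have hb : 0 ≤ b := by positivity
  -- the chemical-potential terms: `(e₁ - e₀) x - (e₂ - e₁)(x + 1) ≤ η x`
  have hchem : (e₁ - e₀) * x - (e₂ - e₁) * (x + 1) ≤ η * x := by nlinarith
  have hkls' : x ^ 2 ≤ b * ((P + Λ) + η * x) := by
    calc x ^ 2 ≤ b * (P + Λ + (e₁ - e₀) * x - (e₂ - e₁) * (x + 1)) := hkls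
      _ ≤ b * ((P + Λ) + η * x) := by
          refine mul_le_mul_of_nonneg_left ?_ hb
          linarith
  -- the quadratic inequality (`TwoSectorGdTransfer.kls_quadratic`)
  have hq := kls_quadratic hb (by positivity) hη hkls'
  -- split the square root: `√(u + v) ≤ √u + √v`
  have hsplit : Real.sqrt (b * (P + Λ)) ≤ Real.sqrt (b * P) + Real.sqrt (b * Λ) := by
    have hu : 0 ≤ b * P := by positivity
    have hv : 0 ≤ b * Λ := by positivity
    rw [mul_add, Real.sqrt_le_left (by positivity)]
    nlinarith [Real.sq_sqrt hu, Real.sq_sqrt hv, Real.sqrt_nonneg (b * P), Real.sqrt_nonneg (b * Λ)]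
  -- the three terms
  have hP2 : c ^ 4 * σ ^ 4 ≤ P ^ 2 := by
    calc c ^ 4 * σ ^ 4 = (c ^ 2 * σ ^ 2) ^ 2 := by ring
      _ ≤ P ^ 2 := pow_le_pow_left₀ hcσ2.le hPσ 2
  have ht4 : b * η ≤ B * ρ * η / c ^ 4 / σ ^ 4 := by
    rw [hb_def, div_div, div_mul_eq_mul_div]
    exact div_le_div_of_nonneg_left (by positivity) (by positivity) hP2
  have hsqrtP : c * σ ≤ Real.sqrt P := by
    rw [Real.le_sqrt hcσ.le hP.le]
    calc (c * σ) ^ 2 = c ^ 2 * σ ^ 2 := by ring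
      _ ≤ P := hPσ
  have ht1 : Real.sqrt (b * P) ≤ Real.sqrt B * Real.sqrt ρ / c / σ := by
    have h1 : b * P = B * ρ / P := by
      rw [hb_def]; field_simp
    rw [h1, Real.sqrt_div' _ hP.le, Real.sqrt_mul hB, div_div]
    exact div_le_div_of_nonneg_left (by positivity) hcσ hsqrtP
  have ht2 : Real.sqrt (b * Λ) ≤ Real.sqrt B * Real.sqrt ρ * Real.sqrt Λ / c ^ 2 / σ ^ 2 := by
    have h1 : b * Λ = B * ρ * Λ / P ^ 2 := by
      rw [hb_def]; field_simp
    rw [h1, Real.sqrt_div' _ (by positivity), Real.sqrt_sq hP.le, Real.sqrt_mul (by positivity),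
      Real.sqrt_mul hB, div_div]
    exact div_le_div_of_nonneg_left (by positivity) hcσ2 hPσ
  linarith

/-! ### The `d = 3` lattice sums over the window -/

/-- **Window sum in `d = 3`.** For a finite set `S` of lattice modes inside a sup-norm shell
`1 ≤ ‖k‖_∞ ≤ M` of a finite `U ⊂ ℤ³` and a profile `g ≤ A₄/‖k‖_∞⁴ + A₁/‖k‖_∞ + A₂/‖k‖_∞²` (`Aᵢ ≥ 0`) on `S`:
`∑_{k ∈ S} g(k) ≤ 192 A₄ + 96 A₁ M² + 96 A₂ M` (shell counting on `ℤ³`: `∑_{‖k‖_∞ ≥ 1} ‖k‖_∞⁻⁴ ≤ 192`,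
`∑_{1 ≤ ‖k‖_∞ ≤ M} ‖k‖_∞⁻¹ ≤ 96 M²`, `∑_{1 ≤ ‖k‖_∞ ≤ M} ‖k‖_∞⁻² ≤ 96 M`; the linear growth of the last sum is
the `d = 3` fact behind mode counting). [cite: KLS1988PRL, (5)–(9)] -/
theorem modeCount_windowSum_le (U S : Finset (Fin 3 → ℤ)) (M : ℕ) {A₄ A₁ A₂ : ℝ} (h4 : 0 ≤ A₄)
    (h1 : 0 ≤ A₁) (h2 : 0 ≤ A₂) (g : (Fin 3 → ℤ) → ℝ)
    (hS : S ⊆ U.filter (fun n => 1 ≤ (Finset.univ.sup fun j => (n j).natAbs) ∧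
      (Finset.univ.sup fun j => (n j).natAbs) ≤ M))
    (hg : ∀ k ∈ S, g k ≤ A₄ / (((Finset.univ.sup fun j => (k j).natAbs : ℕ)) : ℝ) ^ 4 +
      A₁ / (((Finset.univ.sup fun j => (k j).natAbs : ℕ)) : ℝ) +
        A₂ / (((Finset.univ.sup fun j => (k j).natAbs : ℕ)) : ℝ) ^ 2) :
    ∑ k ∈ S, g k ≤ 192 * A₄ + 96 * A₁ * (M : ℝ) ^ 2 + 96 * A₂ * M := by
  set T := U.filter (fun n => 1 ≤ (Finset.univ.sup fun j => (n j).natAbs) ∧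
    (Finset.univ.sup fun j => (n j).natAbs) ≤ M) with hT
  set T' := U.filter (fun n => 1 ≤ (Finset.univ.sup fun j => (n j).natAbs)) with hT'
  have hTT' : T ⊆ T' := by
    intro n hn
    rw [hT, Finset.mem_filter] at hn
    exact Finset.mem_filter.2 ⟨hn.1, hn.2.1⟩
  have hsum4 : ∑ k ∈ T, ((((Finset.univ.sup fun j => (k j).natAbs : ℕ)) : ℝ) ^ 4)⁻¹ ≤ 192 := by
    calc ∑ k ∈ T, ((((Finset.univ.sup fun j => (k j).natAbs : ℕ)) : ℝ) ^ 4)⁻¹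
        ≤ ∑ k ∈ T', ((((Finset.univ.sup fun j => (k j).natAbs : ℕ)) : ℝ) ^ 4)⁻¹ :=
          Finset.sum_le_sum_of_subset_of_nonneg hTT' fun _ _ _ => by positivity
      _ ≤ 192 / ((1 : ℕ) : ℝ) := sum_inv_supNorm_pow_four_le U le_rfl
      _ = 192 := by norm_num
  have hsum1 := sum_inv_supNorm_le U M
  have hsum2 := sum_inv_supNorm_sq_le U M
  rw [← hT] at hsum1 hsum2
  calc ∑ k ∈ S, g k
      ≤ ∑ k ∈ S, (A₄ / (((Finset.univ.sup fun j => (k j).natAbs : ℕ)) : ℝ) ^ 4 +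
          A₁ / (((Finset.univ.sup fun j => (k j).natAbs : ℕ)) : ℝ) +
            A₂ / (((Finset.univ.sup fun j => (k j).natAbs : ℕ)) : ℝ) ^ 2) := Finset.sum_le_sum hg
    _ ≤ ∑ k ∈ T, (A₄ / (((Finset.univ.sup fun j => (k j).natAbs : ℕ)) : ℝ) ^ 4 +
          A₁ / (((Finset.univ.sup fun j => (k j).natAbs : ℕ)) : ℝ) +
            A₂ / (((Finset.univ.sup fun j => (k j).natAbs : ℕ)) : ℝ) ^ 2) :=
        Finset.sum_le_sum_of_subset_of_nonneg hS fun _ _ _ => by positivity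
    _ = A₄ * ∑ k ∈ T, ((((Finset.univ.sup fun j => (k j).natAbs : ℕ)) : ℝ) ^ 4)⁻¹ +
          A₁ * ∑ k ∈ T, ((((Finset.univ.sup fun j => (k j).natAbs : ℕ)) : ℝ))⁻¹ +
            A₂ * ∑ k ∈ T, ((((Finset.univ.sup fun j => (k j).natAbs : ℕ)) : ℝ) ^ 2)⁻¹ := by
        rw [Finset.sum_add_distrib, Finset.sum_add_distrib, Finset.mul_sum, Finset.mul_sum,
          Finset.mul_sum]
        simp only [div_eq_mul_inv]
    _ ≤ A₄ * 192 + A₁ * (96 * (M : ℝ) ^ 2) + A₂ * (96 * (M : ℝ)) := by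
        gcongr
    _ = 192 * A₄ + 96 * A₁ * (M : ℝ) ^ 2 + 96 * A₂ * M := by ring

/-! ### Smallness of the window for small density -/

/-- **The window carries at most `(N+1)/8` particles for small `ρ`.** With `c = 2π/L`, `ρL³ = N+1`,
`η = √(ρa)/L`, `Λ = 2(N+1)‖v‖₁/L³`, the amplitudes `A₄ = Bρη/c⁴`, `A₁ = √B√ρ/c`, `A₂ = √B√ρ√Λ/c²` of
`modeCount_perMode` and a shell radius `M ≤ M₀√ρ√a L/(2π)`, the window total `192A₄ + 96A₁M² + 96A₂M` equals
`(N+1)·√ρ·K` with `K = 12B√a/π⁴ + 12M₀²a√B/π³ + 12M₀√a√B√(2‖v‖₁)/π³`, hence is `≤ (N+1)/8` as soon as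
`√ρ (8K + 8) ≤ 1`. [cite: KLS1988PRL, (5)–(9)] -/
theorem modeCount_window_small {B ρ a V L M₀ M K Nr : ℝ} (hB : 0 ≤ B) (hρ : 0 ≤ ρ) (ha : 0 ≤ a)
    (hL : 0 < L) (hM₀ : 0 ≤ M₀) (hM0 : 0 ≤ M)
    (hM : M ≤ M₀ * Real.sqrt ρ * Real.sqrt a * L / (2 * Real.pi)) (hNr : ρ * L ^ 3 = Nr)
    (hK : 12 * B * Real.sqrt a / Real.pi ^ 4 + 12 * M₀ ^ 2 * a * Real.sqrt B / Real.pi ^ 3 +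
      12 * M₀ * Real.sqrt a * Real.sqrt B * Real.sqrt (2 * V) / Real.pi ^ 3 ≤ K)
    (hsmall : Real.sqrt ρ * (8 * K + 8) ≤ 1) :
    192 * (B * ρ * (Real.sqrt (ρ * a) / L) / (2 * Real.pi / L) ^ 4) +
      96 * (Real.sqrt B * Real.sqrt ρ / (2 * Real.pi / L)) * M ^ 2 +
        96 * (Real.sqrt B * Real.sqrt ρ * Real.sqrt (2 * Nr * V / L ^ 3) / (2 * Real.pi / L) ^ 2) * M ≤
      Nr / 8 := by
  -- atoms
  set r : ℝ := Real.sqrt ρ with hr_def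
  set α : ℝ := Real.sqrt a with hα_def
  set β : ℝ := Real.sqrt B with hβ_def
  set γ : ℝ := Real.sqrt (2 * V) with hγ_def
  have hr : 0 ≤ r := Real.sqrt_nonneg _
  have hα : 0 ≤ α := Real.sqrt_nonneg _
  have hβ : 0 ≤ β := Real.sqrt_nonneg _
  have hγ : 0 ≤ γ := Real.sqrt_nonneg _
  have hr2 : r ^ 2 = ρ := Real.sq_sqrt hρ
  have hα2 : α ^ 2 = a := Real.sq_sqrt ha
  have hβ2 : β ^ 2 = B := Real.sq_sqrt hB
  have hπ : 0 < Real.pi := Real.pi_pos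
  have hρa : Real.sqrt (ρ * a) = r * α := Real.sqrt_mul hρ a
  have hΛ : Real.sqrt (2 * Nr * V / L ^ 3) = r * γ := by
    have h1 : 2 * Nr * V / L ^ 3 = ρ * (2 * V) := by
      rw [← hNr]; field_simp
    rw [h1, Real.sqrt_mul hρ]
  have hK0 : 0 ≤ K := le_trans (by positivity) hK
  -- the three terms as multiples of `r³ L³`
  have hT4 : 192 * (B * ρ * (Real.sqrt (ρ * a) / L) / (2 * Real.pi / L) ^ 4) =
      r ^ 3 * L ^ 3 * (12 * B * α / Real.pi ^ 4) := by
    rw [hρa, ← hr2]; field_simp; ring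
  have hT1 : 96 * (Real.sqrt B * Real.sqrt ρ / (2 * Real.pi / L)) * M ^ 2 ≤
      r ^ 3 * L ^ 3 * (12 * M₀ ^ 2 * a * β / Real.pi ^ 3) := by
    have hM2 : M ^ 2 ≤ (M₀ * r * α * L / (2 * Real.pi)) ^ 2 := pow_le_pow_left₀ hM0 hM 2
    calc 96 * (Real.sqrt B * Real.sqrt ρ / (2 * Real.pi / L)) * M ^ 2
        ≤ 96 * (β * r / (2 * Real.pi / L)) * (M₀ * r * α * L / (2 * Real.pi)) ^ 2 :=
          mul_le_mul_of_nonneg_left hM2 (by positivity)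
      _ = r ^ 3 * L ^ 3 * (12 * M₀ ^ 2 * a * β / Real.pi ^ 3) := by
          rw [← hα2]; field_simp; ring
  have hT2 : 96 * (Real.sqrt B * Real.sqrt ρ * Real.sqrt (2 * Nr * V / L ^ 3) / (2 * Real.pi / L) ^ 2) * M ≤
      r ^ 3 * L ^ 3 * (12 * M₀ * α * β * γ / Real.pi ^ 3) := by
    calc 96 * (Real.sqrt B * Real.sqrt ρ * Real.sqrt (2 * Nr * V / L ^ 3) / (2 * Real.pi / L) ^ 2) * M
        ≤ 96 * (β * r * (r * γ) / (2 * Real.pi / L) ^ 2) * (M₀ * r * α * L / (2 * Real.pi)) := by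
          rw [hΛ]; exact mul_le_mul_of_nonneg_left hM (by positivity)
      _ = r ^ 3 * L ^ 3 * (12 * M₀ * α * β * γ / Real.pi ^ 3) := by
          field_simp; ring
  -- total `≤ r³ L³ K ≤ r² L³ / 8`
  have hK' : 12 * B * α / Real.pi ^ 4 + 12 * M₀ ^ 2 * a * β / Real.pi ^ 3 +
      12 * M₀ * α * β * γ / Real.pi ^ 3 ≤ K := hK
  have hrK : r * K ≤ 1 / 8 := by nlinarith
  calc _ ≤ r ^ 3 * L ^ 3 * (12 * B * α / Real.pi ^ 4) + r ^ 3 * L ^ 3 * (12 * M₀ ^ 2 * a * β / Real.pi ^ 3) +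
        r ^ 3 * L ^ 3 * (12 * M₀ * α * β * γ / Real.pi ^ 3) := by rw [hT4]; gcongr
    _ = r ^ 2 * L ^ 3 * (r * (12 * B * α / Real.pi ^ 4 + 12 * M₀ ^ 2 * a * β / Real.pi ^ 3 +
        12 * M₀ * α * β * γ / Real.pi ^ 3)) := by ring
    _ ≤ r ^ 2 * L ^ 3 * (r * K) := by gcongr
    _ ≤ r ^ 2 * L ^ 3 * (1 / 8) := by gcongr
    _ = Nr / 8 := by rw [hr2, hNr]; ring

/-! ### The window total -/

/-- **The infrared window of the `d = 3` mode count carries at most `(N+1)/8` particles.** For a finite set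
`S` of window modes inside the sup-norm shell `1 ≤ ‖k‖_∞ ≤ M` (`M ≤ M₀√(ρa)L/(2π)`), occupations `x_k ≥ 0`
obeying the hole-channel KLS inequality at the Gaussian-domination value `b = Bρ/P_k²`
(`P_k = ‖2πk/L‖² ≥ (2π/L)²‖k‖_∞²`, `Λ = 2(N+1)‖v‖₁/L³`), with `E₀(N+1) ≤ E₀(N+2)` and near-convexity
`2E₀(N+1) ≤ E₀(N+2) + E₀(N) + √(ρa)/L`, and `ρL³ = N+1`: `∑_{k∈S} x_k ≤ (N+1)/8` provided
`√ρ·(8K + 8) ≤ 1`, `K = K(a, B, ‖v‖₁, M₀)` the explicit window constant. This is (5)–(9) of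
Kennedy–Lieb–Shastry's mode count with the `T = 0` continuum bookkeeping of LSSY Thm 2.2.
[cite: KLS1988PRL, (5)–(9)] -/
theorem modeCount_window_total (U S : Finset (Fin 3 → ℤ)) (Mb : ℕ) {B ρ a V L M₀ K Nr e₀ e₁ e₂ : ℝ}
    (hB : 0 ≤ B) (hρ : 0 ≤ ρ) (ha : 0 ≤ a) (hV : 0 ≤ V) (hL : 0 < L) (hM₀ : 0 ≤ M₀)
    (hMb : (Mb : ℝ) ≤ M₀ * Real.sqrt ρ * Real.sqrt a * L / (2 * Real.pi)) (hNr : ρ * L ^ 3 = Nr)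
    (hNr0 : 0 ≤ Nr)
    (hK : 12 * B * Real.sqrt a / Real.pi ^ 4 + 12 * M₀ ^ 2 * a * Real.sqrt B / Real.pi ^ 3 +
      12 * M₀ * Real.sqrt a * Real.sqrt B * Real.sqrt (2 * V) / Real.pi ^ 3 ≤ K)
    (hsmall : Real.sqrt ρ * (8 * K + 8) ≤ 1)
    (h12 : e₁ ≤ e₂) (hconv : 2 * e₁ ≤ e₂ + e₀ + Real.sqrt (ρ * a) / L)
    (hS : S ⊆ U.filter (fun n => 1 ≤ (Finset.univ.sup fun j => (n j).natAbs) ∧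
      (Finset.univ.sup fun j => (n j).natAbs) ≤ Mb))
    (x P : (Fin 3 → ℤ) → ℝ) (hx : ∀ k ∈ S, 0 ≤ x k)
    (hPσ : ∀ k ∈ S, (2 * Real.pi / L) ^ 2 * (((Finset.univ.sup fun j => (k j).natAbs : ℕ)) : ℝ) ^ 2 ≤ P k)
    (hkls : ∀ k ∈ S, x k ^ 2 ≤ B * ρ / P k ^ 2 *
      (P k + 2 * Nr * V / L ^ 3 + (e₁ - e₀) * x k - (e₂ - e₁) * (x k + 1))) :
    ∑ k ∈ S, x k ≤ Nr / 8 := by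
  have hc : 0 < 2 * Real.pi / L := by positivity
  have hη : 0 ≤ Real.sqrt (ρ * a) / L := by positivity
  have hΛ : 0 ≤ 2 * Nr * V / L ^ 3 := by positivity
  -- per-mode profile
  have hg : ∀ k ∈ S, x k ≤
      B * ρ * (Real.sqrt (ρ * a) / L) / (2 * Real.pi / L) ^ 4 /
          (((Finset.univ.sup fun j => (k j).natAbs : ℕ)) : ℝ) ^ 4 +
        Real.sqrt B * Real.sqrt ρ / (2 * Real.pi / L) / (((Finset.univ.sup fun j => (k j).natAbs : ℕ)) : ℝ) +
        Real.sqrt B * Real.sqrt ρ * Real.sqrt (2 * Nr * V / L ^ 3) / (2 * Real.pi / L) ^ 2 /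
          (((Finset.univ.sup fun j => (k j).natAbs : ℕ)) : ℝ) ^ 2 := by
    intro k hk
    have hk1 : 1 ≤ (Finset.univ.sup fun j => (k j).natAbs) := (Finset.mem_filter.1 (hS hk)).2.1
    have hσ : (0 : ℝ) < (((Finset.univ.sup fun j => (k j).natAbs : ℕ)) : ℝ) := by
      have : (1 : ℝ) ≤ (((Finset.univ.sup fun j => (k j).natAbs : ℕ)) : ℝ) := by exact_mod_cast hk1
      linarith
    exact modeCount_perMode (hx k hk) hΛ hη hB hρ h12 hconv (hkls k hk) hc hσ (hPσ k hk)
  -- lattice sums and smallness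
  have hsum := modeCount_windowSum_le U S Mb (A₄ := B * ρ * (Real.sqrt (ρ * a) / L) / (2 * Real.pi / L) ^ 4)
    (A₁ := Real.sqrt B * Real.sqrt ρ / (2 * Real.pi / L))
    (A₂ := Real.sqrt B * Real.sqrt ρ * Real.sqrt (2 * Nr * V / L ^ 3) / (2 * Real.pi / L) ^ 2)
    (by positivity) (by positivity) (by positivity) x hS hg
  have hsmall' := modeCount_window_small (M := (Mb : ℝ)) hB hρ ha hL hM₀ (Nat.cast_nonneg Mb) hMb hNr hK
    hsmall (V := V)
  linarith

end Summit.AtomisticToContinuum.BoseEinsteinCondensation.Theorems.CorrectorClosure.InsertionModeGaussianDomination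

end
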